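import Summits.BirchSwinnertonDyer.BirchSwinnertonDyer.Theorems.GoldfeldAllTwistsTwoConverseTwinHeegnerHalvesParityCell
import Summits.BirchSwinnertonDyer.BirchSwinnertonDyer.Theorems.PrintCf2SplitBadTwoTamagawaSevenDvd
import HarnessLib

set_option linter.dupNamespace false -- `…BirchSwinnertonDyer.BirchSwinnertonDyer…` is the cell's namespace (D-0017)
set_option autoImplicit false

/-!
# Twin″ (item 19140) — line «heegner-halves» v2: **P1 ON THE WHOLE `j = −3375` CELL** — the hypothesis `7 ∤ d` of
# `…TwinHeegnerHalvesParityCell` removed (the `49a3`-twists, `7 ∣ d`, via `c₇ = 2` of type `III*`)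

Leafhand `leafhand-bsd-goldfeldalltwistst-3-g1` (prover, explicit unit, 2026-08-31; director-bsd (719)(3): the keyed
follow-up generation on the PROVABLE sub-target «P1 on the cell» only), `--supports stmt-BirchSwinnertonDyer-19140`
(crux twin″ `BSDTwoCMSevenAdditiveRankOne`, registered skeleton `5ff791a1e67d6e63` = line «heegner-halves» v2).
Theses-free; theorems only; no `sorry`, no definition, no new named fact, no instance, no notation. HONEST FRAMING:
the crux MOD 2 on the whole `j = −3375` part of the cell, GRANTED the published binders the half-stubs already carry
(Gross–Zagier, Kolyvagin, GZK, modularity, Burungale–Flach) plus Cassels–Tate (and Carayol for the stubs' level); it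
closes NO stub of the line; item 19140 is NOT closed; BSD is proved for no curve.

WHAT. `…TwinHeegnerHalvesParityCell` (p800882) proved P1 — `ord₂ 𝔮` EVEN, `𝔮 = cmHeegnerIndexQuotient W K P Dt.c k Wd Cd.u` —
for the globally minimal models of `49a1^{(d)}`, `d ≢ 1 (mod 4)`, under `7 ∤ d`, the only reason being that seat c301's
uniform Tamagawa law was typed for `7 ∤ d`. Cell bsd-print-cf2 has meanwhile landed the `7 ∣ d` complement
(`PrintCf2SplitBadTwoTamagawaSevenDvd`: `c₇ = 2` of Kodaira type `III*` by a kernel-checked deep Tate certificate, and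
`tamagawaProduct_eq_of_smul_eq_cm7_quadraticTwist_of_dvd`). THIS FILE joins the two:
* §1 `tamagawaProduct_eq_of_smul_eq_cm7_quadraticTwist'` — `∏_p c_p(W) = 8·∏_{ℓ ∣ d, ℓ ∤ 14}(2 | 4)` for EVERY squarefree
  `d ≢ 1 (mod 4)`; exponent form `ord₂ ∏c_p(W) = 3 + ι(d) + 2σ′(d)` with the `ι` of `ParityCore` (`card_filter_erase_seven_eq`),
  and the same for the twin `Wd ≅ 49a1^{(d·D)}` (`padicValNat_two_tamagawaProduct_twin'`);
* §2 `heegnerDiscr_arith_of_split'` — the Heegner discriminant arithmetic without the clause at `7`;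
* §3 **`even_padicValRat_cmHeegnerIndexQuotient_of_cellTwist'`** — P1 for every squarefree `d ≢ 1 (mod 4)`, and
  **`even_padicValRat_cmHeegnerIndexQuotient_of_j_neg3375`** — P1 IN THE ITEM'S OWN TERMS: for every globally minimal `W`
  with `j = −3375` NOT good at `2` and every admissible Heegner datum exactly as quantified in the two half-stubs, granted the
  halves' binders + Cassels–Tate + Carayol (`N = N_W`), `Even (padicValRat 2 𝔮)`.
So on the `j = −3375` cell both registered half-stubs compare two EVEN integers (`ord₂ 𝔮`, `ord₂ #Ш(W)`); a candidate
closer producing an odd `ord₂ 𝔮` has a normalisation slip. WHAT REMAINS of «P1 on the cell»: the `j = 16581375` curves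
(`49a2`/`49a4` twists, `ℚ`-isogenous to the above: `n = 2` and their own Tamagawa law — not in the tree; the LINE does not
need them, the item reducing to `j = −3375` by Cassels, `bsdTwoCMSevenAdditiveRankOne_iff_j_neg3375`).

References: [Kramer1981] Thm. 1; [GrossZagier1986] I.6.3, V.§2; [BurungaleFlach2024] Thm. 1.1, Cor. 2; [MilneADT2006]
I.6.13; [Silverman1994] IV.9.4, Table 4.1; [SilvermanAEC2009] VII.6, X.5; [IrelandRosen1990] 13.1.3–4; [DiamondShurman2005]
Thm. 8.8.1; [Miller2011LMS] §1.
-/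

noncomputable section

open scoped Classical

open WeierstrassCurve NumberField Literature.NumberTheory.EllipticCurves Literature.NumberTheory.QuadraticFields
  Literature.NumberTheory.EllipticCurves.ModularForms Literature.NumberTheory.EllipticCurves.Rank1Residual
  Literature.NumberTheory.EllipticCurves.Rank1Residual.Typed

namespace Summit.BirchSwinnertonDyer.BirchSwinnertonDyer.Theorems.GoldfeldGoodTwists

open Summit.BirchSwinnertonDyer.Rank1Residual Summit.BirchSwinnertonDyer.Rank1Residual.P2

/-! ## §1 The uniform Tamagawa law for EVERY squarefree `d ≢ 1 (mod 4)` and its exponent form -/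

section Tamagawa

variable {d : ℤ}

/-- **`∏_p c_p(W) = 8 · ∏_{ℓ ∣ d, ℓ ∤ 14} (2 if (ℓ/7) = −1 else 4)` FOR EVERY MODEL `W` OF `49a1^{(d)}`, EVERY squarefree
`d ≢ 1 (mod 4)`** — seat c301's law (`7 ∤ d`, where the `erase 7` is void) and cell bsd-print-cf2's `7 ∣ d` complement
(`PrintCf2.TamagawaPlaces.tamagawaProduct_eq_of_smul_eq_cm7_quadraticTwist_of_dvd`, `c₇ = 2` of type `III*`) in one
statement. [cite: Silverman1994, IV.9.4 and Table 4.1] [cite: SilvermanAEC2009, VII.6 and X.5 Cor. 5.4] -/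
theorem tamagawaProduct_eq_of_smul_eq_cm7_quadraticTwist' (hsq : Squarefree d) (hd4 : d % 4 ≠ 1)
    (W : WeierstrassCurve ℚ) [W.IsElliptic] (C : VariableChange ℚ) (hC : C • W = cm7.quadraticTwist (d : ℚ)) :
    W.tamagawaProduct = 8 * ∏ l ∈ ((d.natAbs.primeFactors.erase 2).erase 7), (if jacobiSym l 7 = -1 then 2 else 4) := by
  by_cases h7 : (7 : ℤ) ∣ d
  · exact PrintCf2.TamagawaPlaces.tamagawaProduct_eq_of_smul_eq_cm7_quadraticTwist_of_dvd hsq hd4 h7 W C hC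
  · have h7Q : (7 : ℕ) ∉ d.natAbs.primeFactors.erase 2 := by
      rw [Finset.mem_erase, Nat.mem_primeFactors]
      rintro ⟨-, -, h, -⟩
      exact h7 (by exact_mod_cast (Int.ofNat_dvd_left.mpr h : ((7 : ℕ) : ℤ) ∣ d))
    rw [Finset.erase_eq_of_notMem h7Q]
    exact tamagawaProduct_eq_of_smul_eq_cm7_quadraticTwist hsq hd4 h7 W C hC

/-- **The `erase 7` does not change the inert count**: `(7/7) = 0 ≠ −1`, so
`#{ℓ ∈ (s ∖ {2}) ∖ {7} : (ℓ/7) = −1} = #{ℓ ∈ s ∖ {2} : (ℓ/7) = −1}` — the `ι(d)` below is the `ι(d)` of `ParityCore`. [folklore] -/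
theorem card_filter_erase_seven_eq (s : Finset ℕ) :
    (((s.erase 2).erase 7).filter (fun l : ℕ => jacobiSym l 7 = -1)).card =
      ((s.erase 2).filter (fun l : ℕ => jacobiSym l 7 = -1)).card := by
  rw [Finset.filter_erase, Finset.erase_eq_of_notMem]
  intro h
  have h7 : jacobiSym (7 : ℕ) 7 = -1 := (Finset.mem_filter.mp h).2
  rw [jacobiSym.mod_left] at h7
  norm_num at h7

/-- **`ord₂ ∏_p c_p(W) = 3 + ι(d) + 2σ′(d)` for every model `W` of `49a1^{(d)}`, EVERY squarefree `d ≢ 1 (mod 4)`** (`ι(d)` =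
number of odd prime factors of `d` inert in `ℚ(√−7)`, as in `ParityCore`; `σ′(d)` = number of prime factors `ℓ ∤ 14` split).
[cite: Silverman1994, IV.9.4 and Table 4.1] -/
theorem padicValNat_two_tamagawaProduct_of_smul_eq_cm7_quadraticTwist' (hsq : Squarefree d) (hd4 : d % 4 ≠ 1)
    (W : WeierstrassCurve ℚ) [W.IsElliptic] (C : VariableChange ℚ) (hC : C • W = cm7.quadraticTwist (d : ℚ)) :
    padicValNat 2 W.tamagawaProduct =
      3 + ((d.natAbs.primeFactors.erase 2).filter (fun l : ℕ => jacobiSym l 7 = -1)).card +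
        2 * (((d.natAbs.primeFactors.erase 2).erase 7).filter (fun l : ℕ => ¬ jacobiSym l 7 = -1)).card := by
  haveI : Fact (Nat.Prime 2) := ⟨Nat.prime_two⟩
  have h := tamagawaProduct_eq_of_smul_eq_cm7_quadraticTwist' hsq hd4 W C hC
  rw [Finset.prod_ite, Finset.prod_const, Finset.prod_const, card_filter_erase_seven_eq] at h
  rw [h, show (8 : ℕ) * (2 ^ ((d.natAbs.primeFactors.erase 2).filter (fun l : ℕ => jacobiSym l 7 = -1)).card *
      4 ^ (((d.natAbs.primeFactors.erase 2).erase 7).filter (fun l : ℕ => ¬ jacobiSym l 7 = -1)).card) =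
      2 ^ (3 + ((d.natAbs.primeFactors.erase 2).filter (fun l : ℕ => jacobiSym l 7 = -1)).card +
        2 * (((d.natAbs.primeFactors.erase 2).erase 7).filter (fun l : ℕ => ¬ jacobiSym l 7 = -1)).card) by
      rw [pow_add, pow_add, pow_mul]; norm_num; ring]
  exact padicValNat.prime_pow _

/-- The twin's exponent: `ord₂ ∏_p c_p(Wd) = 3 + ι(d·D) + 2σ′(d·D)` for every model `Wd` of `W^{(D)}`, `W` a model of `49a1^{(d)}`,
`d·D` squarefree and `≢ 1 (mod 4)` (no hypothesis at `7`). [cite: Silverman1994, IV.9.4 and Table 4.1] -/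
theorem padicValNat_two_tamagawaProduct_twin' {D : ℤ} (hsqD : Squarefree (d * D)) (hdD4 : (d * D) % 4 ≠ 1)
    (W : WeierstrassCurve ℚ) (C : VariableChange ℚ) (hC : C • W = cm7.quadraticTwist (d : ℚ))
    (Wd : WeierstrassCurve ℚ) [Wd.IsElliptic] (Cd : VariableChange ℚ) (hWd : Cd • W.quadraticTwist (D : ℚ) = Wd) :
    padicValNat 2 Wd.tamagawaProduct =
      3 + (((d * D).natAbs.primeFactors.erase 2).filter (fun l : ℕ => jacobiSym l 7 = -1)).card +
        2 * ((((d * D).natAbs.primeFactors.erase 2).erase 7).filter (fun l : ℕ => ¬ jacobiSym l 7 = -1)).card := by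
  obtain ⟨C', hC', -⟩ := exists_smul_eq_cm7_quadraticTwist_mul W C hC Wd Cd hWd
  exact padicValNat_two_tamagawaProduct_of_smul_eq_cm7_quadraticTwist' hsqD hdD4 Wd C' (by rw [hC', Int.cast_mul])

end Tamagawa

/-! ## §2 The Heegner discriminant of the cell (no hypothesis at `7`) -/

section Discriminant

variable {K : Type} [Field K] [NumberField K]

/-- **Arithmetic of an admissible Heegner discriminant on the cell, any `d`.** If `K` is imaginary quadratic and every prime
factor of `14·|d|` splits in `K` (`d` squarefree, `d ≢ 1 (mod 4)`), then `D = d_K` has `D < 0`, `D` squarefree, `(D/7) = 1`,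
`gcd(d, D) = 1`, `d·D` squarefree and `d·D ≢ 1 (mod 4)` (`heegnerDiscr_arith_of_split` without its clause at `7`).
[cite: IrelandRosen1990, Prop. 13.1.3 and 13.1.4] [cite: Gross1984, §3 (Heegner hypothesis)] -/
theorem heegnerDiscr_arith_of_split' (hK : IsImaginaryQuadratic K) {d : ℤ} (hsq : Squarefree d) (hd4 : d % 4 ≠ 1)
    (hHd : SatisfiesHeegnerHypothesis (14 * d.natAbs) K) :
    NumberField.discr K < 0 ∧ Squarefree (NumberField.discr K) ∧ jacobiSym (NumberField.discr K) 7 = 1 ∧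
      Int.gcd d (NumberField.discr K) = 1 ∧ Squarefree (d * NumberField.discr K) ∧
      (d * NumberField.discr K) % 4 ≠ 1 := by
  have h2 : Module.finrank ℚ K = 2 := hK.1
  have hDneg : NumberField.discr K < 0 := hK.discr_neg
  have hs2 := hHd 2 Nat.prime_two (dvd_mul_of_dvd_left (by norm_num) _)
  have hD8 : NumberField.discr K % 8 = 1 := by
    refine (Quadratic.ncard_primesOver_two_eq_two_iff h2).mp ?_
    simpa using hs2
  have hD7 : jacobiSym (NumberField.discr K) 7 = 1 :=
    (Quadratic.ncard_primesOver_eq_two_iff_jacobiSym h2 (by norm_num) (by norm_num)).mp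
      (hHd 7 (by norm_num) (dvd_mul_of_dvd_left (by norm_num) _))
  have hDsq : Squarefree (NumberField.discr K) := by
    rcases Quadratic.isFundamentalDiscriminant_discr (K := K) h2 with ⟨-, hsqD, -⟩ | ⟨h4, -, -⟩
    · exact hsqD
    · exfalso; omega
  have hcopN : Nat.Coprime d.natAbs (NumberField.discr K).natAbs := by
    refine Nat.coprime_of_dvd fun l hl hld hlD => ?_
    have hlD' : (l : ℤ) ∣ NumberField.discr K := Int.natCast_dvd.mpr hlD
    by_cases hl2 : l = 2
    · subst hl2; omega
    · exact not_dvd_discr_of_ncard_primesOver_eq_two h2 hl hl2 (hHd l hl (dvd_mul_of_dvd_right hld _)) hlD'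
  have hcop : Int.gcd d (NumberField.discr K) = 1 := by rw [Int.gcd_eq_natAbs]; exact hcopN
  have hsqD : Squarefree (d * NumberField.discr K) :=
    squarefree_mul_iff.mpr ⟨(Int.isCoprime_iff_gcd_eq_one.mpr hcop).isRelPrime, hsq, hDsq⟩
  have hdD4 : (d * NumberField.discr K) % 4 ≠ 1 := by
    rw [Int.mul_emod, show NumberField.discr K % 4 = 1 by omega, mul_one, Int.emod_emod_of_dvd _ (dvd_refl _)]
    exact hd4
  exact ⟨hDneg, hDsq, hD7, hcop, hsqD, hdD4⟩

end Discriminant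

/-! ## §3 P1 on the whole `j = −3375` cell -/

section ParityLaw

variable {d : ℤ}

/-- **P1 ON THE WHOLE `j = −3375` CELL (twist currency, NO hypothesis at `7`).** `d` squarefree, `d ≢ 1 (mod 4)`; `W` a
globally minimal model of `49a1^{(d)}` (`C • W = X₀(49)^{(d)}` — by `exists_squarefree_twist_of_j_neg3375_of_not_good_two` this is
EVERY globally minimal `W` with `j = −3375` additive at `2`); `(N, K, Dt, H, ι, P, Wd, Cd, k)` an admissible Heegner datum
as in the halves of the line, the Heegner hypothesis holding for `N` and for the bad primes `2, 7, ℓ ∣ d` (`hHd`; automatic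
for `N = N_W`). GRANTED Gross–Zagier, Kolyvagin, GZK, modularity, Burungale–Flach and Cassels–Tate: **`ord₂ 𝔮` is EVEN**,
`𝔮 = cmHeegnerIndexQuotient W K P Dt.c k Wd Cd.u`. Same assembly as `even_padicValRat_cmHeegnerIndexQuotient_of_cellTwist`
(p800882) with the uniform Tamagawa law of §1. [cite: Kramer1981, Thm. 1] [cite: GrossZagier1986, Thm. I.6.3 and V.§2]
[cite: BurungaleFlach2024, Thm. 1.1 and Cor. 2] [cite: Silverman1994, IV.9 Table 4.1] [cite: MilneADT2006, Thm. I.6.13] -/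
theorem even_padicValRat_cmHeegnerIndexQuotient_of_cellTwist'
    (hCT : exists_casselsTate_pairing (K := ℚ))
    (hsq : Squarefree d) (hd4 : d % 4 ≠ 1)
    (W : WeierstrassCurve ℚ) [W.IsElliptic] [W.IsGloballyMinimal] (C : VariableChange ℚ)
    (hC : C • W = cm7.quadraticTwist (d : ℚ))
    (N : ℕ) [NeZero N] (K : Type) [Field K] [NumberField K]
    (Dt : ModularParametrizationData W N) (H : HeegnerDatum N (NumberField.discr K)) (ι : K →+* ℂ)
    (P : (W.baseChange K).toAffine.Point)
    (hGZ : gross_zagier N W K) (hKo : kolyvagin N W K)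
    (hGZK : rank_eq_analyticRank_of_analyticRank_le_one) (hmod : hasEntireLFunction_rat)
    (hBF : bsdTriple_of_hasCM_of_L_one_ne_zero)
    (hK : IsImaginaryQuadratic K) (hHN : SatisfiesHeegnerHypothesis N K)
    (hHd : SatisfiesHeegnerHypothesis (14 * d.natAbs) K)
    (hP : WeierstrassCurve.Affine.Point.map ι.toRatAlgHom P = heegnerPointComplex Dt H)
    (hr : W.analyticRank = 1)
    (hLt : (W.quadraticTwist (NumberField.discr K : ℚ)).entireLFunction 1 ≠ 0)
    (Wd : WeierstrassCurve ℚ) [Wd.IsElliptic] [Wd.IsGloballyMinimal] (Cd : VariableChange ℚ)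
    (hWd : Cd • W.quadraticTwist (NumberField.discr K : ℚ) = Wd) (k : ℕ) (hk12 : k = 1 ∨ k = 2) :
    Even (padicValRat 2 (cmHeegnerIndexQuotient W K P Dt.c k Wd Cd.u)) := by
  haveI : Fact (Nat.Prime 2) := ⟨Nat.prime_two⟩
  have hd0 : d ≠ 0 := hsq.ne_zero
  obtain ⟨hj, hcm, -⟩ := minimalModel_quadraticTwist_cm7 hd0 W C hC
  ---------------------------------------------------------------- the arithmetic of `D = d_K`
  obtain ⟨hDneg, hDsq, hD7, hcop, hsqD, hdD4⟩ := heegnerDiscr_arith_of_split' hK hsq hd4 hHd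
  ---------------------------------------------------------------- non-degeneracy of the datum (the binders)
  obtain ⟨-, -, -, -, hfinpt, hfind, hI0, -, -⟩ := heegnerDatum_nondegenerate_of_facts W N K Dt H ι P hGZ hKo
    hGZK hmod hBF hcm hK hHN hP hr hLt Wd Cd hWd
  haveI := hfinpt
  haveI := hfind
  ---------------------------------------------------------------- the factors
  have hn : (W.baseChange ℝ).numRealComponents = 1 := numRealComponents_eq_one_of_j_eq_neg3375 W hj
  have hu : |(Cd.u : ℚ)| = 1 := abs_u_eq_one_of_twin_minimal hsq hd4 hsqD hdD4 W C hC Wd Cd hWd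
  have hcW := padicValNat_two_tamagawaProduct_of_smul_eq_cm7_quadraticTwist' hsq hd4 W C hC
  have hcWd := padicValNat_two_tamagawaProduct_twin' hsqD hdD4 W C hC Wd Cd hWd
  have hshaSq : IsSquare Wd.shaOrder := isSquare_card_sha_of_finite_of_casselsTate hCT Wd
  have hsha0 : Wd.shaOrder ≠ 0 := (Nat.card_pos (α := Wd.sha)).ne'
  have hshaEven : Even (padicValNat 2 Wd.shaOrder) := by
    obtain ⟨m, hm⟩ := hshaSq
    have hm0 : m ≠ 0 := by rintro rfl; exact hsha0 (by rw [hm])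
    rw [hm, padicValNat.mul hm0 hm0]
    exact ⟨_, rfl⟩
  have hodd := odd_card_inertSeven_add_mul_of_heegnerDiscr hd0 hDneg (Int.squarefree_natAbs.mpr hDsq) hD7 hcop
  ---------------------------------------------------------------- non-vanishing
  have htW : 0 < W.torsionOrder := W.torsionOrder_pos_holds
  have htK : 0 < (W.baseChange K).torsionOrder := by
    haveI := KrizLi2019.isElliptic_baseChange' W K; exact (W.baseChange K).torsionOrder_pos_holds
  have hcWpos : 0 < W.tamagawaProduct := W.tamagawaProduct_pos_holds
  have hcWdpos : 0 < Wd.tamagawaProduct := Wd.tamagawaProduct_pos_holds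
  have hw : 0 < Units.torsionOrder K := Units.torsionOrder_pos K
  have hpts : Nat.card Wd.toAffine.Point ≠ 0 := (Nat.card_pos (α := Wd.toAffine.Point)).ne'
  have hk0 : (k : ℚ) ≠ 0 := by rcases hk12 with rfl | rfl <;> norm_num
  rw [even_padicValRat_cmHeegnerIndexQuotient_iff W K P Dt.c k Wd Cd.u (by exact_mod_cast hI0)
    (by exact_mod_cast htW.ne') hk0 (by exact_mod_cast htK.ne') (Int.cast_ne_zero.mpr Dt.maninConstant_ne_zero_holds)
    (by exact_mod_cast hw.ne') (by exact_mod_cast hpts) (by rw [hn]; norm_num) (by exact_mod_cast hsha0)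
    (by exact_mod_cast hcWdpos.ne') (by rw [hu]; norm_num) (by exact_mod_cast hcWpos.ne')]
  rw [hn, hu, Nat.cast_one, one_mul, mul_one,
    show (8 : ℚ) / ((Wd.shaOrder : ℚ) * (Wd.tamagawaProduct : ℚ) * (W.tamagawaProduct : ℚ)) =
      (((2 ^ 3 : ℕ) : ℕ) : ℚ) / ((Wd.shaOrder * Wd.tamagawaProduct * W.tamagawaProduct : ℕ) : ℚ) by push_cast; ring,
    padicValRat.div (by positivity) (by exact_mod_cast mul_ne_zero (mul_ne_zero hsha0 hcWdpos.ne') hcWpos.ne'),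
    padicValRat.of_nat, padicValRat.of_nat, padicValNat.prime_pow,
    padicValNat.mul (mul_ne_zero hsha0 hcWdpos.ne') hcWpos.ne', padicValNat.mul hsha0 hcWdpos.ne', hcW, hcWd]
  obtain ⟨m, hm⟩ := hshaEven
  obtain ⟨r, hr⟩ := hodd
  rw [hm, Int.even_iff]
  push_cast
  omega

/-- **P1 on the whole `j = −3375` cell, Heegner hypothesis at the conductor.** [cite: Kramer1981, Thm. 1] [cite: Gross1984, §3] -/
theorem even_padicValRat_cmHeegnerIndexQuotient_of_cellTwist_of_conductorNorm'
    (hCT : exists_casselsTate_pairing (K := ℚ))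
    (hsq : Squarefree d) (hd4 : d % 4 ≠ 1)
    (W : WeierstrassCurve ℚ) [W.IsElliptic] [W.IsGloballyMinimal] (C : VariableChange ℚ)
    (hC : C • W = cm7.quadraticTwist (d : ℚ))
    (N : ℕ) [NeZero N] (K : Type) [Field K] [NumberField K]
    (Dt : ModularParametrizationData W N) (H : HeegnerDatum N (NumberField.discr K)) (ι : K →+* ℂ)
    (P : (W.baseChange K).toAffine.Point)
    (hGZ : gross_zagier N W K) (hKo : kolyvagin N W K)
    (hGZK : rank_eq_analyticRank_of_analyticRank_le_one) (hmod : hasEntireLFunction_rat)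
    (hBF : bsdTriple_of_hasCM_of_L_one_ne_zero)
    (hK : IsImaginaryQuadratic K) (hHN : SatisfiesHeegnerHypothesis N K)
    (hHW : SatisfiesHeegnerHypothesis (W.conductorNorm ℤ) K)
    (hP : WeierstrassCurve.Affine.Point.map ι.toRatAlgHom P = heegnerPointComplex Dt H)
    (hr : W.analyticRank = 1)
    (hLt : (W.quadraticTwist (NumberField.discr K : ℚ)).entireLFunction 1 ≠ 0)
    (Wd : WeierstrassCurve ℚ) [Wd.IsElliptic] [Wd.IsGloballyMinimal] (Cd : VariableChange ℚ)
    (hWd : Cd • W.quadraticTwist (NumberField.discr K : ℚ) = Wd) (k : ℕ) (hk12 : k = 1 ∨ k = 2) :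
    Even (padicValRat 2 (cmHeegnerIndexQuotient W K P Dt.c k Wd Cd.u)) :=
  even_padicValRat_cmHeegnerIndexQuotient_of_cellTwist' hCT hsq hd4 W C hC N K Dt H ι P hGZ hKo hGZK hmod hBF
    hK hHN (satisfiesHeegnerHypothesis_cellLevel_of_conductorNorm hsq hd4 W C hC hHW) hP hr hLt Wd Cd hWd k hk12

/-- **P1 ON THE `j = −3375` CELL IN THE ITEM'S OWN TERMS, granted Carayol.** For every globally minimal `W/ℚ` with
`j(W) = −3375` NOT good at `2` (equivalently: CM with `2` split in the CM field and `j = −3375`, additive at `2`) and every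
admissible Heegner datum EXACTLY as quantified in `stub_heegnerIndexUpperAtTwo` / `stub_heegnerIndexLowerAtTwo` (level `N` of
the parametrisation datum, Heegner hypothesis for `N`), granted the halves' binders, Cassels–Tate and Carayol's
`IsNewformOf.level_eq_conductorNorm` (`N = N_W`): `ord₂ 𝔮` is even. The twist parameter is produced inside the proof
(`exists_variableChange_eq_quadraticTwist_intCast_of_j_eq`; `d ≢ 1 (mod 4)` from the bad reduction at `2`).
[cite: Kramer1981, Thm. 1] [cite: DiamondShurman2005, Thm. 8.8.1] [cite: SilvermanAEC2009, X.5 Prop. 5.4 and Cor. 5.4.1] -/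
theorem even_padicValRat_cmHeegnerIndexQuotient_of_j_neg3375
    (hCT : exists_casselsTate_pairing (K := ℚ))
    (W : WeierstrassCurve ℚ) [W.IsElliptic] [W.IsGloballyMinimal] (hj : W.j = -3375)
    (hg : ¬ W.HasGoodReductionAtPrime 2)
    (N : ℕ) [NeZero N] (hCar : IsNewformOf.level_eq_conductorNorm (N := N))
    (K : Type) [Field K] [NumberField K]
    (Dt : ModularParametrizationData W N) (H : HeegnerDatum N (NumberField.discr K)) (ι : K →+* ℂ)
    (P : (W.baseChange K).toAffine.Point)
    (hGZ : gross_zagier N W K) (hKo : kolyvagin N W K)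
    (hGZK : rank_eq_analyticRank_of_analyticRank_le_one) (hmod : hasEntireLFunction_rat)
    (hBF : bsdTriple_of_hasCM_of_L_one_ne_zero)
    (hK : IsImaginaryQuadratic K) (hHN : SatisfiesHeegnerHypothesis N K)
    (hP : WeierstrassCurve.Affine.Point.map ι.toRatAlgHom P = heegnerPointComplex Dt H)
    (hr : W.analyticRank = 1)
    (hLt : (W.quadraticTwist (NumberField.discr K : ℚ)).entireLFunction 1 ≠ 0)
    (Wd : WeierstrassCurve ℚ) [Wd.IsElliptic] [Wd.IsGloballyMinimal] (Cd : VariableChange ℚ)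
    (hWd : Cd • W.quadraticTwist (NumberField.discr K : ℚ) = Wd) (k : ℕ) (hk12 : k = 1 ∨ k = 2) :
    Even (padicValRat 2 (cmHeegnerIndexQuotient W K P Dt.c k Wd Cd.u)) := by
  obtain ⟨d, hd0, hsq, C, hC⟩ := exists_variableChange_eq_quadraticTwist_intCast_of_j_eq
    (W := W) (E := cm7) (by rw [hj, j_cm7]) (by rw [j_cm7]; norm_num) (by rw [j_cm7]; norm_num)
  have hd4 : d % 4 ≠ 1 := by
    intro hd4
    haveI : Fact (Nat.Prime 2) := ⟨Nat.prime_two⟩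
    exact hg (hasGoodReductionAtPrime_and_frobeniusTrace_of_smul_eq_quadraticTwist_two cm7 W hd4 hC 2 rfl
      hasGoodReductionAtPrime_cm7_two).1
  exact even_padicValRat_cmHeegnerIndexQuotient_of_cellTwist' hCT hsq hd4 W C hC N K Dt H ι P hGZ hKo hGZK hmod hBF
    hK hHN (satisfiesHeegnerHypothesis_cellLevel_of_level_eq hsq hd4 W C hC (Dt.level_eq_conductorNorm_holds hCar) hHN)
    hP hr hLt Wd Cd hWd k hk12

end ParityLaw

end Summit.BirchSwinnertonDyer.BirchSwinnertonDyer.Theorems.GoldfeldGoodTwists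

end
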